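import Mathlib
import HarnessLib
import Summits.HubbardSuperconductivity.HubbardSuperconductivity.Theorems.WeakCouplingBCSKlCertTPrimeJoint
import Summits.HubbardSuperconductivity.HubbardSuperconductivity.Theorems.WeakCouplingBCSKlCertB1gTPm03D0125EngineRows

/-!
# Route `WeakCouplingBCS` — certificate half of `WcbcsKohnLuttingerB1g` (stmt-HubbardSuperconductivity-0158):
# the JOINT-ENCLOSURE record appendix of the `(⅛, −0.3)` certificate `klCertB1gTPm03D0125` — `γ_J = 88361/2²⁰ = +0.0843` (binding rival `A2g`)
# (KL-MARGIN-SCAN cell `(δ, t′/t) = (⅛, −0.3)` of the gate cell `gate-hubbard-kl`; successor docket «W3′-RECORD-SHAPE» line (ε′), pen (R424)(B))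

HONEST FRAMING: ONE cell `(δ, t′) = (⅛, −3/10)`; certified arithmetic on a DECIDED kit table; `B1g` dominance MODULO the named unproved hypotheses
`JointEnclosuresB1gTP klCertB1gTPm03D0125 klCertB1gTPm03D0125JRows (−3/10)` (E1–E2 of the `B1g` block + the four JOINT enclosures `dJ_χ`, new kind of
`Theorems/WeakCouplingBCSKlCertTPrimeJoint.lean`) and `KLTPAnalytic` per `μ` (or, in §3, the three numerical engine rows of
`Theorems/WeakCouplingBCSKlCertB1gTPm03D0125EngineRows.lean`), NONE of which is proved here; `γ_J = 88361/2²⁰ = +0.0843` is in the JOINT-ENCLOSURE currency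
(docket option (ε)) — NOT the pre-registered pairwise currency of the DECIDED word (R412) (`+0.0435`) and NOT the separate-enclosure currency of the (δ) record
(`γ = 33811/2²⁰ = +0.0322`, p714295), beside both of which it is printed, replacing neither; nothing about other cells, `K₃`, `U₀`, the doping window or
superconductivity.  A Kohn–Luttinger `O(U²)` channel statement is not ODLRO; nothing here proves superconductivity in the Hubbard model.

WHAT THE KERNEL DECIDES (`decide +kernel`): the JOINT checker `checkB1gJ` of `Theorems/WeakCouplingBCSKlCertTPrimeJoint.lean` accepts the UNCHANGED (δ) record
object `klCertB1gTPm03D0125` (`Theorems/WeakCouplingBCSDefsKlCertB1gTPm03D0125Record.lean`: its μ-box, its `B1g` Ritz block, its four rival deflation lists,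
its 24 trigonometric polynomials) together with ONE joint row `klCertB1gTPm03D0125JRows = [(dJ_A1g, dJ_A2g, dJ_B2g, dJ_E)]` and `γ_J`: cover of `[mub, mua]`,
`B1g` Ritz usability (`ritzOK`), admissible rival deflations (`deflOK`), the `withU` tests, and `γ_J ≤ −dJ_χ` for the four rivals (equality on `A2g`).
WHAT STAYS A NAMED HYPOTHESIS: per `μ` of the box, `RitzEnclosureTP` of the `B1g` block (E1–E2, existing kind) and, for each rival `χ`,
`JointEnclosureTP bB bχ tab (−3/10) μ χ dJ_χ :↔ √(HS²_χ/dmult χ) + q_B1g/Nhi ≤ dJ_χ` for the TRUE kernel `χ₀[ε_{−0.3}]` (new kind); and `KLTPAnalytic` (§2) or the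
three engine rows (§3).
THE LITERALS: `dJ_A1g = −118845/2²⁰`, `dJ_A2g = −88361/2²⁰`, `dJ_B2g = −120877/2²⁰`, `dJ_E = −124683/2²⁰` are the OUTWARD (toward `+∞`) `2⁻²⁰`-dyadic roundings
`−⌊γ_χ · 2²⁰⌋ / 2²⁰` of the outward hull `γ_χ := min(impl-1, impl-2)` of the two in-seat implementations' certified joint margins on the production table
(impl-1 | impl-2: `A1g 0.113339980163 | …195`, `A2g 0.084268269480 | …511`, `B2g 0.115277955574 | …606`, `E 0.118907678752 | …752`; agreement ≤ 4·10⁻¹¹);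
`γ_J := −dJ_A2g = 88361/2²⁰` (the binding rival).
PROVENANCE: production hull table of kit job j326170 `hulls.json` sha16 045debf42bd1189c (μ-UNIFORM route-(J) engine `HOME/margin-1-g15/code/kitjob5`, N = 192;
pen (R412) «DECIDED») + the cell geometry `HOME/margin-1-g17/stage2j/out/geo.json` d86b73855835482e (NF = 32) + the FROZEN (δ) record `record-tp-m03-d0125-hull-frozen.json`
69bef4c727c3359c (its `Nhi = 27166861623/2³²`, deflation lists and `B1g` trial = the tree object `klCertB1gTPm03D0125`) → stage-2″ in TWO in-seat implementations
(margin-1 g17, zero kit): impl-1 `HOME/margin-1-g17/stage2j/joint2.py` (1-D rivals; NQ = 8 coarse slots, one AM–GM pivot `s₀` per channel: `A2g 0.15`, `A1g/B2g 0.12`)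
+ `joint2E.py` (`E`; NQ = 4, `s₀ = 0.12`, four `i`-slices) — outward-rounded binary64, libm angle/trig ranges padded — outputs `stage2j/joint/joint2_{A1g,A2g,B2g,E}.json`,
`joint2E_*_0.12.json`; impl-2 `HOME/margin-1-g17/stage2j/joint_impl2.py` (independent code, corner-major organisation, 44-digit-decimal trig/angle ranges of
`out2_nf32/trig_img*.json`, own directed rounding) — outputs `stage2j/joint/impl2/joint_<χ>_<s0>_<ilo>_<ihi>.json`, hull `joint_compare.json`; refuter
hubbard-klscan-crit-1 g4 byte replays 7/7 (impl-1) + 10/10 (impl-2) and re-derivation of the `E` constants (KL STATUS 2026-08-29 11:43Z / 12:13Z / 12:33Z);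
memo `HOME/margin-1-g17/RECORD-SHAPE-STAGE2J.md` §10/§10b; row literals = planner hubbard-klscan-idea-3 g17 `r17/jrows.json` 5b34f3acc1b014ff, re-derived by
margin-1 g18 from `joint_compare.json`.  The arithmetic the two implementations instantiate is the orientation-split entrywise Lagrange dual PROVED in
`Theorems/WeakCouplingBCSKlCertTPrimeJointDual.lean` (`corner_bound`, `split_dual_le`, `coset_dual_le`): `√X ≤ (X + s₀²)/(2s₀)` makes `√(HS²/dmult) + q/Nhi` an
integral of a pointwise CONVEX function of the eight hull deviations of a cell pair, maximal at a vertex of the orientation-class parallelogram (1-D rivals) /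
of the `C₂`-coset rectangles (`E`).  What separates the hypotheses from a Lean proof is the replay of that interval arithmetic inside Lean — not numerics.

* §1 generic: the JOINT window theorems with `KLTPAnalytic` replaced by three ENGINE ROWS (`kltpj_window_U_of_engineRows`, `kltpj_window_of_engineRows`;
  twins of `kltp_window(_U)_of_engineRows` of `Theorems/WeakCouplingBCSKlCertTPrimeWindowOfEngineRows.lean`, generic in `tp`, the record and the rows).
* §2 the cell: `klCertB1gTPm03D0125JRows`, `klCertB1gTPm03D0125GammaJ`, the kernel decision `klCertB1gTPm03D0125_checkJ`, and `B1g` dominance by `γ_J` at `U = 1`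
  (`_dominatesAtJ`) and at every `0 < U < 1` (`_dominatesJ`) MODULO `KLTPAnalytic` + `JointEnclosuresB1gTP`.
* §3 the cell from engine rows: `_dominatesJ_of_engineRows` / `_dominatesAtJ_of_engineRows` — the same conclusions MODULO the three numerical engine rows of
  p714676 (E1 speed floor `37/25`, E2 `χ₀` sup `53/100`, E3 positivity `9/10` at table indices `1, 5, 9, 12`) + `JointEnclosuresB1gTP`, NO abstract analytic
  hypothesis left; and the kernel-checked comparison `γ < γ_J`, `(26/10)·γ < γ_J` with the (δ) record's `γ`.

References: S. Raghu, S. A. Kivelson, D. J. Scalapino, Phys. Rev. B 81 (2010) 224505, §III (17) and Fig. 3 (`t′ ≠ 0`: `d_{x²−y²}` leads near `n = 0.875`,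
`t′ = −0.3t`); M. Reed, B. Simon, *Methods of Modern Mathematical Physics IV*, §XIII.1 (Ritz, min–max); S. M. Rump, Acta Numerica 19 (2010) 287–449, §10.
-/

noncomputable section

-- the tree's namespace `Summit.<Summit>.<Problem>.Theorems` repeats the summit name by design (D-0017)
set_option linter.dupNamespace false

namespace Summit.HubbardSuperconductivity.HubbardSuperconductivity.Theorems

open MeasureTheory Real CwKLChiralWindow KlCertTPrimeJoint Literature.MathematicalPhysics.QuantumLattice

/-! ### §1 Generic: the JOINT window theorems from three engine rows -/

/-- Every box of a record whose joint rows have the right length is paired with a joint row in `c.boxes.zip rows`. [folklore] -/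
theorem kltpj_box_pair (c : KLCert) (rows : List KLJRow) (hlen : rows.length = c.boxes.length) {bx : KLBox} (hbx : bx ∈ c.boxes) :
    ∃ r : KLJRow, (bx, r) ∈ c.boxes.zip rows := by
  obtain ⟨i, hi, hbxi⟩ := List.mem_iff_getElem.1 hbx
  subst hbxi
  have hiz : i < (c.boxes.zip rows).length := by
    rw [List.length_zip]; omega
  have hmem : (c.boxes.zip rows)[i] ∈ c.boxes.zip rows := List.getElem_mem hiz
  rw [List.getElem_zip] at hmem
  exact ⟨_, hmem⟩

/-- **The JOINT `t′` window statement at every weak coupling from ENGINE ROWS** (generic in `tp`, the record and the joint rows): an accepted joint record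
(`checkB1gJ c rows γ`), its joint enclosures `JointEnclosuresB1gTP c rows tp`, and per box, uniformly in `μ`: (E1) a speed-square floor
`0 < w ≤ (2 sin k₀ (1 + 2t′ cos k₁))² + (2 sin k₁ (1 + 2t′ cos k₀))²` on the Fermi curve, (E2) `|χ₀[ε_{t′}](k + k′)| ≤ C` on `F × F`, (E3) for every `χ ≠ B1g` a table
index `i` with `(klTab c.trials i).fits χ` and `0 < ∫ (klTab c.trials i).toFun² dσ` — give `KLB1gDominatesTP tp mub mua γ`.  The `B1g` witness is the record's Ritz
trial (`ritzOK` of `jointBoxOK`: `fits B1g`, `0 < Nlo`; E1 of `JointEnclosuresB1gTP`: `Nlo ≤ ∫ Φ² dσ`). [cite: RaghuKivelsonScalapino2010, §II (5)-(8) and §III (17)] -/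
theorem kltpj_window_U_of_engineRows (tp : ℝ) (c : KLCert) (rows : List KLJRow) (γ : ℚ) (hc : checkB1gJ c rows γ = true) {w C : ℝ} (hw : 0 < w)
    (hspeed : ∀ bx ∈ c.boxes, ∀ μ ∈ Set.Icc (bx.mulo : ℝ) (bx.muhi : ℝ), ∀ k ∈ fermiCurve (squareDispersion 1 tp) μ,
      w ≤ (2 * sin (k 0) * (1 + 2 * tp * cos (k 1))) ^ 2 + (2 * sin (k 1) * (1 + 2 * tp * cos (k 0))) ^ 2)
    (hC : ∀ bx ∈ c.boxes, ∀ μ ∈ Set.Icc (bx.mulo : ℝ) (bx.muhi : ℝ),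
      ∀ k ∈ fermiCurve (squareDispersion 1 tp) μ, ∀ k' ∈ fermiCurve (squareDispersion 1 tp) μ,
        |lindhardFunction (squareDispersion 1 tp) μ (k + k')| ≤ C)
    (hpos : ∀ bx ∈ c.boxes, ∀ μ ∈ Set.Icc (bx.mulo : ℝ) (bx.muhi : ℝ), ∀ χ : D4Irrep, χ ≠ D4Irrep.B1g →
      ∃ i : ℕ, (klTab c.trials i).fits χ = true ∧ 0 < ∫ k, (klTab c.trials i).toFun k ^ 2 ∂fermiCurveMeasure (squareDispersion 1 tp) μ)
    (hE : JointEnclosuresB1gTP c rows tp) :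
    KLB1gDominatesTP tp ((c.mub : ℚ) : ℝ) ((c.mua : ℚ) : ℝ) ((γ : ℚ) : ℝ) := by
  refine kltpj_window_U tp c rows γ hc (fun bx hbx μ hμ => ?_) hE
  obtain ⟨-, hlen, hall, -⟩ := kltpj_coverLogic c rows γ hc
  obtain ⟨r, hmem⟩ := kltpj_box_pair c rows hlen hbx
  have hJ := hall _ hmem
  simp only [jointBoxOK, Bool.and_eq_true] at hJ
  obtain ⟨⟨⟨⟨hritz, -⟩, -⟩, -⟩, -⟩ := hJ
  have hritz' := hritz
  simp only [KLBlock.ritzOK, Bool.and_eq_true, decide_eq_true_eq] at hritz'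
  obtain ⟨⟨⟨⟨⟨⟨⟨-, -⟩, hfits⟩, hNlo⟩, -⟩, -⟩, -⟩, -⟩ := hritz'
  refine klph_tprime_analytic_of_engineRows tp μ hw (hspeed bx hbx μ hμ) (hC bx hbx μ hμ) (fun χ => ?_)
  by_cases hχ : χ = D4Irrep.B1g
  · subst hχ
    have hE1 : ((bx.bB1g.Nlo : ℚ) : ℝ) ≤ ∫ k, (klTab c.trials bx.bB1g.trial).toFun k ^ 2 ∂fermiCurveMeasure (squareDispersion 1 tp) μ :=
      (hE _ hmem μ hμ).1.1
    have hNlo' : (0 : ℝ) < ((bx.bB1g.Nlo : ℚ) : ℝ) := by exact_mod_cast hNlo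
    exact kltp_engineRow_trial _ _ hfits (hNlo'.trans_le hE1)
  · obtain ⟨i, hfits_i, hpos_i⟩ := hpos bx hbx μ hμ χ hχ
    exact kltp_engineRow_trial _ _ hfits_i hpos_i

/-- **The `U = 1` form from engine rows**: `KLB1gDominatesAtTP tp mub mua γ` under the same joint record, rows and enclosures.
[cite: RaghuKivelsonScalapino2010, §III (17)] -/
theorem kltpj_window_of_engineRows (tp : ℝ) (c : KLCert) (rows : List KLJRow) (γ : ℚ) (hc : checkB1gJ c rows γ = true) {w C : ℝ} (hw : 0 < w)
    (hspeed : ∀ bx ∈ c.boxes, ∀ μ ∈ Set.Icc (bx.mulo : ℝ) (bx.muhi : ℝ), ∀ k ∈ fermiCurve (squareDispersion 1 tp) μ,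
      w ≤ (2 * sin (k 0) * (1 + 2 * tp * cos (k 1))) ^ 2 + (2 * sin (k 1) * (1 + 2 * tp * cos (k 0))) ^ 2)
    (hC : ∀ bx ∈ c.boxes, ∀ μ ∈ Set.Icc (bx.mulo : ℝ) (bx.muhi : ℝ),
      ∀ k ∈ fermiCurve (squareDispersion 1 tp) μ, ∀ k' ∈ fermiCurve (squareDispersion 1 tp) μ,
        |lindhardFunction (squareDispersion 1 tp) μ (k + k')| ≤ C)
    (hpos : ∀ bx ∈ c.boxes, ∀ μ ∈ Set.Icc (bx.mulo : ℝ) (bx.muhi : ℝ), ∀ χ : D4Irrep, χ ≠ D4Irrep.B1g →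
      ∃ i : ℕ, (klTab c.trials i).fits χ = true ∧ 0 < ∫ k, (klTab c.trials i).toFun k ^ 2 ∂fermiCurveMeasure (squareDispersion 1 tp) μ)
    (hE : JointEnclosuresB1gTP c rows tp) :
    KLB1gDominatesAtTP tp ((c.mub : ℚ) : ℝ) ((c.mua : ℚ) : ℝ) ((γ : ℚ) : ℝ) := by
  refine kltpj_window tp c rows γ hc (fun bx hbx μ hμ => ?_) hE
  obtain ⟨-, hlen, hall, -⟩ := kltpj_coverLogic c rows γ hc
  obtain ⟨r, hmem⟩ := kltpj_box_pair c rows hlen hbx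
  have hJ := hall _ hmem
  simp only [jointBoxOK, Bool.and_eq_true] at hJ
  obtain ⟨⟨⟨⟨hritz, -⟩, -⟩, -⟩, -⟩ := hJ
  have hritz' := hritz
  simp only [KLBlock.ritzOK, Bool.and_eq_true, decide_eq_true_eq] at hritz'
  obtain ⟨⟨⟨⟨⟨⟨⟨-, -⟩, hfits⟩, hNlo⟩, -⟩, -⟩, -⟩, -⟩ := hritz'
  refine klph_tprime_analytic_of_engineRows tp μ hw (hspeed bx hbx μ hμ) (hC bx hbx μ hμ) (fun χ => ?_)
  by_cases hχ : χ = D4Irrep.B1g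
  · subst hχ
    have hE1 : ((bx.bB1g.Nlo : ℚ) : ℝ) ≤ ∫ k, (klTab c.trials bx.bB1g.trial).toFun k ^ 2 ∂fermiCurveMeasure (squareDispersion 1 tp) μ :=
      (hE _ hmem μ hμ).1.1
    have hNlo' : (0 : ℝ) < ((bx.bB1g.Nlo : ℚ) : ℝ) := by exact_mod_cast hNlo
    exact kltp_engineRow_trial _ _ hfits (hNlo'.trans_le hE1)
  · obtain ⟨i, hfits_i, hpos_i⟩ := hpos bx hbx μ hμ χ hχ
    exact kltp_engineRow_trial _ _ hfits_i hpos_i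

/-! ### §2 The cell `(δ, t′) = (⅛, −3/10)`: the joint row, `γ_J`, the kernel decision, dominance modulo `KLTPAnalytic` + the joint enclosures -/

/-- **The joint row of the one box of `klCertB1gTPm03D0125`**: `(dJ_A1g, dJ_A2g, dJ_B2g, dJ_E) = (−118845, −88361, −120877, −124683)/2²⁰` — outward `2⁻²⁰`
dyadics of the outward hull of the two in-seat implementations' certified joint enclosures on the production table j326170 (see the module docstring).
[cite: RaghuKivelsonScalapino2010, §III Fig. 3] -/
def klCertB1gTPm03D0125JRows : List KLJRow :=
  [⟨((-118845 : ℚ) / 1048576), ((-88361 : ℚ) / 1048576), ((-120877 : ℚ) / 1048576), ((-124683 : ℚ) / 1048576)⟩]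

/-- **The joint margin `γ_J = 88361/2²⁰ ≈ 0.084268`** (`= −dJ_A2g`, the binding rival). [folklore] -/
def klCertB1gTPm03D0125GammaJ : ℚ := (88361 : ℚ) / 1048576

/-- **The JOINT checker accepts the (δ) record object with the joint row** (kernel decision): `mub < mua`, `0 < γ_J`, the box covers `[mub, mua]`, the `B1g`
block passes `ritzOK`, the four rival blocks pass `deflOK` and the `withU` test, and `γ_J ≤ −dJ_χ` for `χ = A1g, A2g, B2g, E`. [folklore] -/
theorem klCertB1gTPm03D0125_checkJ :
    checkB1gJ klCertB1gTPm03D0125 klCertB1gTPm03D0125JRows klCertB1gTPm03D0125GammaJ = true := by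
  decide +kernel

/-- **`B1g` dominance at `U = 1` by `γ_J`, uniformly on the μ-cell of `(δ, t′) = (⅛, −0.3)`, modulo the analytic facts and the JOINT enclosures**:
`KLB1gDominatesAtTP (-3/10) mub mua γ_J`. [cite: RaghuKivelsonScalapino2010, §III Fig. 3] -/
theorem klCertB1gTPm03D0125_dominatesAtJ
    (hA : ∀ bx ∈ klCertB1gTPm03D0125.boxes, ∀ μ ∈ Set.Icc (bx.mulo : ℝ) (bx.muhi : ℝ),
      KLTPAnalytic (squareDispersion 1 (-3 / 10)) μ)
    (hE : JointEnclosuresB1gTP klCertB1gTPm03D0125 klCertB1gTPm03D0125JRows (-3 / 10)) :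
    KLB1gDominatesAtTP (-3 / 10) ((klCertB1gTPm03D0125.mub : ℚ) : ℝ) ((klCertB1gTPm03D0125.mua : ℚ) : ℝ)
      ((klCertB1gTPm03D0125GammaJ : ℚ) : ℝ) :=
  kltpj_window (-3 / 10) klCertB1gTPm03D0125 klCertB1gTPm03D0125JRows klCertB1gTPm03D0125GammaJ
    klCertB1gTPm03D0125_checkJ hA hE

/-- **`B1g` dominance at every weak coupling `0 < U < 1` by `γ_J U²`, uniformly on the μ-cell of `(δ, t′) = (⅛, −0.3)`, modulo the analytic facts and the
JOINT enclosures**: `KLB1gDominatesTP (-3/10) mub mua γ_J`. [cite: RaghuKivelsonScalapino2010, §II (7), (13) and §III Fig. 3] -/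
theorem klCertB1gTPm03D0125_dominatesJ
    (hA : ∀ bx ∈ klCertB1gTPm03D0125.boxes, ∀ μ ∈ Set.Icc (bx.mulo : ℝ) (bx.muhi : ℝ),
      KLTPAnalytic (squareDispersion 1 (-3 / 10)) μ)
    (hE : JointEnclosuresB1gTP klCertB1gTPm03D0125 klCertB1gTPm03D0125JRows (-3 / 10)) :
    KLB1gDominatesTP (-3 / 10) ((klCertB1gTPm03D0125.mub : ℚ) : ℝ) ((klCertB1gTPm03D0125.mua : ℚ) : ℝ)
      ((klCertB1gTPm03D0125GammaJ : ℚ) : ℝ) :=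
  kltpj_window_U (-3 / 10) klCertB1gTPm03D0125 klCertB1gTPm03D0125JRows klCertB1gTPm03D0125GammaJ
    klCertB1gTPm03D0125_checkJ hA hE

/-! ### §3 The cell from ENGINE ROWS (no abstract analytic hypothesis), and the comparison with the (δ) record's `γ` -/

/-- **The `(⅛, −0.3)` record's weak-coupling dominance by `γ_J` from ENGINE ROWS**: if, for every `μ` of the record's box, (E1) `37/25 ≤ ‖∇ε_{−0.3}‖²` on the
Fermi curve, (E2) `|χ₀[ε_{−0.3}](k + k′)| ≤ 53/100` on `F × F`, (E3) `9/10 ≤ ∫ u_i² dσ` for the table entries `i = 1, 5, 9, 12`, and (E-J) the joint enclosures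
`JointEnclosuresB1gTP klCertB1gTPm03D0125 klCertB1gTPm03D0125JRows (-3/10)` hold, then `KLB1gDominatesTP (-3/10) mub mua γ_J`.
[cite: RaghuKivelsonScalapino2010, §II (5)-(8) and §III Fig. 3] -/
theorem klCertB1gTPm03D0125_dominatesJ_of_engineRows
    (hspeed : ∀ bx ∈ klCertB1gTPm03D0125.boxes, ∀ μ ∈ Set.Icc (bx.mulo : ℝ) (bx.muhi : ℝ),
      ∀ k ∈ fermiCurve (squareDispersion 1 (-3 / 10)) μ,
        (37 / 25 : ℝ) ≤ (2 * sin (k 0) * (1 + 2 * (-3 / 10 : ℝ) * cos (k 1))) ^ 2 + (2 * sin (k 1) * (1 + 2 * (-3 / 10 : ℝ) * cos (k 0))) ^ 2)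
    (hC : ∀ bx ∈ klCertB1gTPm03D0125.boxes, ∀ μ ∈ Set.Icc (bx.mulo : ℝ) (bx.muhi : ℝ),
      ∀ k ∈ fermiCurve (squareDispersion 1 (-3 / 10)) μ, ∀ k' ∈ fermiCurve (squareDispersion 1 (-3 / 10)) μ,
        |lindhardFunction (squareDispersion 1 (-3 / 10)) μ (k + k')| ≤ 53 / 100)
    (hpos : ∀ bx ∈ klCertB1gTPm03D0125.boxes, ∀ μ ∈ Set.Icc (bx.mulo : ℝ) (bx.muhi : ℝ), ∀ i ∈ [1, 5, 9, 12],
      (9 / 10 : ℝ) ≤ ∫ k, (klTab klCertB1gTPm03D0125.trials i).toFun k ^ 2 ∂fermiCurveMeasure (squareDispersion 1 (-3 / 10)) μ)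
    (hE : JointEnclosuresB1gTP klCertB1gTPm03D0125 klCertB1gTPm03D0125JRows (-3 / 10)) :
    KLB1gDominatesTP (-3 / 10) ((klCertB1gTPm03D0125.mub : ℚ) : ℝ) ((klCertB1gTPm03D0125.mua : ℚ) : ℝ)
      ((klCertB1gTPm03D0125GammaJ : ℚ) : ℝ) := by
  obtain ⟨h1, h5, h9, h12⟩ := klCertB1gTPm03D0125_rival_fits
  refine kltpj_window_U_of_engineRows (-3 / 10) klCertB1gTPm03D0125 klCertB1gTPm03D0125JRows klCertB1gTPm03D0125GammaJ
    klCertB1gTPm03D0125_checkJ (w := 37 / 25) (C := 53 / 100) (by norm_num) hspeed hC (fun bx hbx μ hμ χ hχ => ?_) hE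
  have hp : ∀ i ∈ [1, 5, 9, 12], 0 < ∫ k, (klTab klCertB1gTPm03D0125.trials i).toFun k ^ 2
      ∂fermiCurveMeasure (squareDispersion 1 (-3 / 10)) μ :=
    fun i hi => lt_of_lt_of_le (by norm_num) (hpos bx hbx μ hμ i hi)
  cases χ with
  | A1g => exact ⟨1, h1, hp 1 (by simp)⟩
  | A2g => exact ⟨5, h5, hp 5 (by simp)⟩
  | B1g => exact absurd rfl hχ
  | B2g => exact ⟨9, h9, hp 9 (by simp)⟩
  | E => exact ⟨12, h12, hp 12 (by simp)⟩

/-- The `U = 1` form from the same engine rows and joint enclosures: `KLB1gDominatesAtTP (-3/10) mub mua γ_J`. [cite: RaghuKivelsonScalapino2010, §III Fig. 3] -/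
theorem klCertB1gTPm03D0125_dominatesAtJ_of_engineRows
    (hspeed : ∀ bx ∈ klCertB1gTPm03D0125.boxes, ∀ μ ∈ Set.Icc (bx.mulo : ℝ) (bx.muhi : ℝ),
      ∀ k ∈ fermiCurve (squareDispersion 1 (-3 / 10)) μ,
        (37 / 25 : ℝ) ≤ (2 * sin (k 0) * (1 + 2 * (-3 / 10 : ℝ) * cos (k 1))) ^ 2 + (2 * sin (k 1) * (1 + 2 * (-3 / 10 : ℝ) * cos (k 0))) ^ 2)
    (hC : ∀ bx ∈ klCertB1gTPm03D0125.boxes, ∀ μ ∈ Set.Icc (bx.mulo : ℝ) (bx.muhi : ℝ),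
      ∀ k ∈ fermiCurve (squareDispersion 1 (-3 / 10)) μ, ∀ k' ∈ fermiCurve (squareDispersion 1 (-3 / 10)) μ,
        |lindhardFunction (squareDispersion 1 (-3 / 10)) μ (k + k')| ≤ 53 / 100)
    (hpos : ∀ bx ∈ klCertB1gTPm03D0125.boxes, ∀ μ ∈ Set.Icc (bx.mulo : ℝ) (bx.muhi : ℝ), ∀ i ∈ [1, 5, 9, 12],
      (9 / 10 : ℝ) ≤ ∫ k, (klTab klCertB1gTPm03D0125.trials i).toFun k ^ 2 ∂fermiCurveMeasure (squareDispersion 1 (-3 / 10)) μ)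
    (hE : JointEnclosuresB1gTP klCertB1gTPm03D0125 klCertB1gTPm03D0125JRows (-3 / 10)) :
    KLB1gDominatesAtTP (-3 / 10) ((klCertB1gTPm03D0125.mub : ℚ) : ℝ) ((klCertB1gTPm03D0125.mua : ℚ) : ℝ)
      ((klCertB1gTPm03D0125GammaJ : ℚ) : ℝ) := by
  obtain ⟨h1, h5, h9, h12⟩ := klCertB1gTPm03D0125_rival_fits
  refine kltpj_window_of_engineRows (-3 / 10) klCertB1gTPm03D0125 klCertB1gTPm03D0125JRows klCertB1gTPm03D0125GammaJ
    klCertB1gTPm03D0125_checkJ (w := 37 / 25) (C := 53 / 100) (by norm_num) hspeed hC (fun bx hbx μ hμ χ hχ => ?_) hE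
  have hp : ∀ i ∈ [1, 5, 9, 12], 0 < ∫ k, (klTab klCertB1gTPm03D0125.trials i).toFun k ^ 2
      ∂fermiCurveMeasure (squareDispersion 1 (-3 / 10)) μ :=
    fun i hi => lt_of_lt_of_le (by norm_num) (hpos bx hbx μ hμ i hi)
  cases χ with
  | A1g => exact ⟨1, h1, hp 1 (by simp)⟩
  | A2g => exact ⟨5, h5, hp 5 (by simp)⟩
  | B1g => exact absurd rfl hχ
  | B2g => exact ⟨9, h9, hp 9 (by simp)⟩
  | E => exact ⟨12, h12, hp 12 (by simp)⟩

/-- **Comparison with the (δ) record (kernel decision)**: `γ_J` exceeds the separate-enclosure margin `gamma = 33811/2²⁰` of the SAME record object by more than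
the factor `26/10` (`88361/33811 = 2.613…`); and the separate charging of the same blocks can never beat a joint row (`jointEnclosureTP_of_separate`). [folklore] -/
theorem klCertB1gTPm03D0125_gamma_lt_gammaJ :
    klCertB1gTPm03D0125.gamma < klCertB1gTPm03D0125GammaJ ∧ (26 : ℚ) / 10 * klCertB1gTPm03D0125.gamma < klCertB1gTPm03D0125GammaJ := by
  refine ⟨by decide +kernel, by decide +kernel⟩

end Summit.HubbardSuperconductivity.HubbardSuperconductivity.Theorems

end
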